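import Literature.Geometry.Lorentzian.CauchyProblemMGHDExistenceProofs
import Literature.Geometry.Lorentzian.DevelopmentGluing
import Literature.Geometry.Lorentzian.DataEmbeddingNormalSmooth
import HarnessLib

/-!
# Choquet-Bruhat–Geroch's Theorem 3: the existence of the MGHD reduced to three displayed inputs

Assembly of the reduction of the named fact
`Literature.Geometry.Lorentzian.choquetBruhat_geroch_exists_mghd_cauchy` (Choquet-Bruhat–Geroch,
Comm. Math. Phys. 14 (1969), Thm. 3; Sbierski, Ann. Henri Poincaré 17 (2016), Thm. 2.8;
Ringström 2009, Thm. 16.6) obtained in the tree so far: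

* the Zorn frame `choquetBruhat_geroch_exists_mghd_cauchy_of_chains_bounded_of_common_extension`
  (`CauchyProblemMGHDExistenceProofs`): the fact follows from (a) *every chain of vacuum Cauchy
  developments has an upper bound* and (b) *any two vacuum Cauchy developments have a common
  extension*;
* (b) from the local theory and Sbierski's Thm. 17,
  `choquetBruhat_geroch_common_extension_of_localTheory_of_mcghd_noCorrespondingBoundary`
  (`DevelopmentGluing`, gluing along the maximal common globally hyperbolic development of
  `MaximalCommonDevelopment`, whose embedding property is Sbierski's Lemma 9,
  `DevelopmentImmersionInjective`), given the differentiability of the future unit normal along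
  the data embedding — now a theorem, `DataEmbedding.mdifferentiableAt_embed_normal`
  (`DataEmbeddingNormalSmooth`).

Hence `choquetBruhat_geroch_exists_mghd_cauchy_of_chains_bounded_of_localTheory_of_noCorrespondingBoundary`:
**the fact follows from exactly three displayed inputs** —

1. `hchain`: every chain (for `≼`) of vacuum Cauchy developments of the data has an upper bound;
2. `hlocal`: any two vacuum Cauchy developments of the data have *some* common globally
   hyperbolic development (Sbierski 2016, Thm. 4 = local existence and local geometric uniqueness
   for the vacuum Einstein equations, Choquet-Bruhat 1952; Ringström 2009, Ch. 14–16);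
3. `h17`: the maximal common globally hyperbolic development of two vacuum Cauchy developments
   has no corresponding boundary points (Sbierski 2016, Thm. 17, proved in §3.2 from Thm. 4 and
   the causal theory of globally hyperbolic developments).

Remark on input 1 (recorded for whoever takes it). In the printed proofs the upper bound of a
chain is "the union" (Choquet-Bruhat–Geroch, p. 333; Ringström 2009, Ch. 23, with the
set-theoretic proviso that all developments be realised on subsets of one fixed set). In the
present typed setting the proviso is a universe constraint: for data on `X : Type` a vacuum
Cauchy development has its carrier in `Type`, while a chain is a `Set` of developments — a type
in `Type 1` — so the naive colimit `(Σ 𝒟 ∈ c, M_𝒟) / ∼` lives one universe too high to be a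
development; as every development is second countable and Hausdorff, hence of cardinality at
most the continuum, the members of a chain can first be realised on subsets of a fixed type of
that cardinality (the printed proviso), after which the colimit is small. Two further points of
the union construction are genuine mathematics rather than bookkeeping: (i) the colimit must be
given a time orientation (the orienting *fields* of the members are not intertwined by the
embeddings, only the future cones are; a smooth future-directed field on the union is obtained
from the consistent cone field by a partition of unity once the union is known to be
paracompact), and (ii) the union is second countable because it carries a Lorentzian metric with
a continuous choice of future cones (Geroch 1968; the time-oriented case is
`TimeOrientation.secondCountableTopology`, `TimeOrientedSecondCountable`). Sbierski's
"dezornification" (§2.3 of the paper) avoids chains but glues *all* developments at once and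
meets the same two points.

No definitions, no named facts.

## References

* Y. Choquet-Bruhat, R. Geroch, *Global aspects of the Cauchy problem in general relativity*,
  Comm. Math. Phys. 14 (1969) 329–335, Thm. 3 and its proof (pp. 332–334).
* J. Sbierski, *On the existence of a maximal Cauchy development for the Einstein equations: a
  dezornification*, Ann. Henri Poincaré 17 (2016) 301–329 = arXiv:1309.7591v3, Thms. 4, 5, 10,
  12, 17 and §2.3.
* H. Ringström, *The Cauchy Problem in General Relativity*, EMS 2009, Thm. 16.6, Ch. 23.
-/

noncomputable section

open Bundle Set Function Filter TopologicalSpace Topology Manifold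
open scoped Manifold ContDiff Topology

namespace Literature.Geometry.Lorentzian

/-- **Choquet-Bruhat–Geroch's Theorem 3 (existence of the MGHD) from three displayed inputs**:
(1) chains of vacuum Cauchy developments are bounded, (2) any two vacuum Cauchy developments have
a common globally hyperbolic development (local existence and uniqueness, Sbierski 2016, Thm. 4),
(3) the MCGHD of any two has no corresponding boundary points (Sbierski 2016, Thm. 17). The Zorn
frame (`choquetBruhat_geroch_exists_mghd_cauchy_of_chains_bounded_of_common_extension`) fed with
the common extension obtained by gluing along the MCGHD
(`choquetBruhat_geroch_common_extension_of_localTheory_of_mcghd_noCorrespondingBoundary`), the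
differentiability of the future unit normal being `DataEmbedding.mdifferentiableAt_embed_normal`.
[cite: Sbierski2016AHP, Thm. 2.8 = arXiv Thm. 5, proof in §3.3 from Thms. 10, 17; ChoquetBruhatGeroch1969CMP, Thm. 3] -/
theorem choquetBruhat_geroch_exists_mghd_cauchy_of_chains_bounded_of_localTheory_of_noCorrespondingBoundary
    (hchain : ∀ (X : Type) [TopologicalSpace X] [ChartedSpace (EuclideanSpace ℝ (Fin 3)) X]
      [IsManifold (𝓡 3) ∞ X] [T2Space X] [SecondCountableTopology X] [ConnectedSpace X]
      (D : InitialDataSet (𝓡 3) X) [D.metric.HasLeviCivita], D.IsVacuumConstraintSolution →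
      ∀ c : Set (VacuumCauchyDevelopment D),
        IsChain (fun 𝒟₁ 𝒟₂ ↦ 𝒟₁.toCauchyDevelopment.EmbedsInto 𝒟₂.toCauchyDevelopment) c →
          ∃ ub : VacuumCauchyDevelopment D,
            ∀ 𝒟 ∈ c, 𝒟.toCauchyDevelopment.EmbedsInto ub.toCauchyDevelopment)
    (hlocal : ∀ (X : Type) [TopologicalSpace X] [ChartedSpace (EuclideanSpace ℝ (Fin 3)) X]
      [IsManifold (𝓡 3) ∞ X] [T2Space X] [SecondCountableTopology X] [ConnectedSpace X]
      (D : InitialDataSet (𝓡 3) X) [D.metric.HasLeviCivita], D.IsVacuumConstraintSolution →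
      ∀ 𝒟 𝒟' : VacuumCauchyDevelopment D, ∃ U : Opens 𝒟.carrier,
        𝒟.toCauchyDevelopment.IsCommonDevelopment 𝒟'.toDataEmbedding U)
    (h17 : ∀ (X : Type) [TopologicalSpace X] [ChartedSpace (EuclideanSpace ℝ (Fin 3)) X]
      [IsManifold (𝓡 3) ∞ X] [T2Space X] [SecondCountableTopology X] [ConnectedSpace X]
      (D : InitialDataSet (𝓡 3) X) [D.metric.HasLeviCivita], D.IsVacuumConstraintSolution →
      ∀ (𝒟 𝒟' : VacuumCauchyDevelopment D)
        (hne : ∃ U : Opens 𝒟.carrier,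
          𝒟.toCauchyDevelopment.IsCommonDevelopment 𝒟'.toDataEmbedding U),
        ¬ (CauchyDevelopment.CommonDevelopment.ofIsCommonDevelopment
          (𝒟.toCauchyDevelopment.isCommonDevelopment_mcghd hne)).HasCorrespondingBoundaryPoints) :
    choquetBruhat_geroch_exists_mghd_cauchy :=
  choquetBruhat_geroch_exists_mghd_cauchy_of_chains_bounded_of_common_extension hchain
    fun X _ _ _ _ _ _ D _ hD ↦
      choquetBruhat_geroch_common_extension_of_localTheory_of_mcghd_noCorrespondingBoundary
        (hlocal X D hD) (h17 X D hD) fun 𝒟 x ↦ 𝒟.toDataEmbedding.mdifferentiableAt_embed_normal x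

end Literature.Geometry.Lorentzian

end
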